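import Summits.AtomisticToContinuum.Crystallization.Theorems.ExcessDecayLiouvilleHcpLiouvilleBlowdownDefs
import Summits.AtomisticToContinuum.Crystallization.Theorems.ExcessDecayLiouvilleEnergyIdentity
import Summits.AtomisticToContinuum.Crystallization.Theorems.ExcessDecayLiouvilleLatticeParam
import Summits.AtomisticToContinuum.Crystallization.Theorems.ExcessDecayLiouvilleTranslation

/-!
# `ExcessDecayLiouville.HcpLiouville` (stmt-AtomisticToContinuum-9332), line `Sketch` v4: the optical block is coercive, I

Part H3c of stub `stub_green`, lead file.  The dipole decomposition of the Green's operator handles a dipole across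
the two sublattices through the OPTICAL force-constant matrix `K_c = Σ_{z ∈ Λ₀} K(t 0 − (t 1 + A z))` (the total
force constant between a site of sublattice `0` and the whole of sublattice `1`), which must be invertible with a
bound.  This file proves the finite-volume inequality behind `⟪K_c ξ, ξ⟫ ≥ κ‖ξ‖²`: testing the harmonic-stability
inequality `Blowdown.PSIneq κ t A` (in operator form, `energy_identity`) with the optical pattern `u = ξ·𝟙_F`,
`F` a finite set of sites of sublattice `0`, gives

`κ · #F · ‖ξ‖² ≤ #F · ⟪K_c ξ, ξ⟫ + 38 ‖ξ‖² · Σ_{p ∈ F} Σ'_{q ∈ S₀ ∖ F} dist(p,q)⁻⁸`   (`Blowdown.optical_finite_volume`).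

Part II lets `F` run through lattice boxes (boundary `O(N²)` against volume `N³`).  All `[folklore]`; a `--supports`
helper for item stmt-AtomisticToContinuum-9332, nothing here closes an item.
-/

noncomputable section

namespace Summit.AtomisticToContinuum.Crystallization.Theorems.ExcessDecayLiouville

open scoped BigOperators Topology Classical InnerProductSpace RealInnerProductSpace
open Literature.MathematicalPhysics.StatisticalMechanics
open Summit.AtomisticToContinuum.Crystallization.Theses.ExcessDecayLiouville
open Summit.AtomisticToContinuum.Crystallization.Theorems.PhononStabilityNegative

namespace Blowdown

section

variable {t : Fin 2 → EuclideanSpace ℝ (Fin 3)} {A : EuclideanSpace ℝ (Fin 3) →L[ℝ] EuclideanSpace ℝ (Fin 3)}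

/-! ## Small facts -/

/-- `Λ₀` is closed under addition. [folklore] -/
theorem add_mem_Λ₀' {z z' : EuclideanSpace ℝ (Fin 3)} (hz : z ∈ Λ₀) (hz' : z' ∈ Λ₀) : z + z' ∈ Λ₀ := by
  obtain ⟨i, j, k, rfl⟩ := hz
  obtain ⟨i', j', k', rfl⟩ := hz'
  exact ⟨i + i', j + j', k + k', (latticeVec_add i j k i' j' k').symm⟩

/-- `Λ₀` is closed under subtraction. [folklore] -/
theorem sub_mem_Λ₀' {z z' : EuclideanSpace ℝ (Fin 3)} (hz : z ∈ Λ₀) (hz' : z' ∈ Λ₀) : z - z' ∈ Λ₀ := by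
  rw [sub_eq_add_neg]; exact add_mem_Λ₀' hz (neg_mem_Λ₀ hz')

/-- `|⟪K(e) ξ, ξ⟫| ≤ 38 ‖e‖⁻⁸ ‖ξ‖²` for bonds `‖e‖ ≥ 9/10`. [folklore] -/
theorem abs_inner_forceConst_le {e : EuclideanSpace ℝ (Fin 3)} (he : 9 / 10 ≤ ‖e‖) (ξ : EuclideanSpace ℝ (Fin 3)) :
    |⟪forceConst e ξ, ξ⟫| ≤ 38 * (‖e‖⁻¹) ^ 8 * ‖ξ‖ ^ 2 := by
  have h1 : ‖forceConst e ξ‖ ≤ 38 * (‖e‖⁻¹) ^ 8 * ‖ξ‖ := by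
    rw [forceConst_apply]; exact norm_forceConst_apply_le he ξ
  calc |⟪forceConst e ξ, ξ⟫| ≤ ‖forceConst e ξ‖ * ‖ξ‖ := abs_real_inner_le_norm _ _
    _ ≤ 38 * (‖e‖⁻¹) ^ 8 * ‖ξ‖ * ‖ξ‖ := mul_le_mul_of_nonneg_right h1 (norm_nonneg _)
    _ = 38 * (‖e‖⁻¹) ^ 8 * ‖ξ‖ ^ 2 := by ring

/-- Distinct sites give bonds of length `≥ 9/10`. [folklore] -/
theorem norm_sub_ge_of_sites (hA : Adm₀ A) (hI : Inner₀ t A) {p q : EuclideanSpace ℝ (Fin 3)} (hp : p ∈ Sites₀ t A)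
    (hq : q ∈ Sites₀ t A) (hpq : p ≠ q) : 9 / 10 ≤ ‖p - q‖ := by
  have := dist_sites_ge hA hI hp hq hpq
  rw [dist_eq_norm] at this; linarith

/-! ## The optical row `Q(ξ) = Σ'_{z ∈ Λ₀} ⟪K(t 0 − (t 1 + A z)) ξ, ξ⟫` -/

/-- The optical row is absolutely summable. [folklore] -/
theorem summable_optRow (hA : Adm₀ A) (hI : Inner₀ t A) (ξ : EuclideanSpace ℝ (Fin 3)) :
    Summable (fun z : Λ₀ => ⟪forceConst (t 0 - (t 1 + A z)) ξ, ξ⟫) := by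
  have h0 : t 0 ∈ Sites₀ t A := ⟨0, 0, zero_mem_Λ₀, by simp⟩
  let i : Λ₀ → Sites₀ t A := fun z => ⟨t 1 + A z, 1, z, z.2, rfl⟩
  have hinj : Function.Injective i := by
    intro z z' h
    have h' : t 1 + A z = t 1 + A z' := congrArg (fun q : Sites₀ t A => (q : EuclideanSpace ℝ (Fin 3))) h
    exact Subtype.ext (injective_of_adm₀ hA (add_left_cancel h'))
  have hs := ((summable_inv_pow_eight_sites hA hI h0).comp_injective hinj).mul_left (38 * ‖ξ‖ ^ 2)
  refine Summable.of_norm_bounded hs fun z => ?_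
  have hne : (t 1 + A z : EuclideanSpace ℝ (Fin 3)) ≠ t 0 := fun h => sublattice_ne hA hI zero_mem_Λ₀ z.2 (by simpa using h.symm)
  have hmem : (t 1 + A z : EuclideanSpace ℝ (Fin 3)) ∈ Sites₀ t A := ⟨1, z, z.2, rfl⟩
  have he := norm_sub_ge_of_sites hA hI h0 hmem hne.symm
  rw [Real.norm_eq_abs]
  refine (abs_inner_forceConst_le he ξ).trans (le_of_eq ?_)
  simp only [Function.comp_apply, i, if_pos hne, dist_eq_norm, norm_sub_rev (t 1 + A z)]
  ring

/-- **Translation invariance of the optical row**: from any site `p = t 0 + A z_p` of sublattice `0`, the sum of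
`⟪K(p − q) ξ, ξ⟫` over sublattice `1` equals `Q(ξ)`. [folklore] -/
theorem tsum_cross_eq_optRow (hA : Adm₀ A) (ξ : EuclideanSpace ℝ (Fin 3)) {zp : EuclideanSpace ℝ (Fin 3)}
    (hzp : zp ∈ Λ₀) :
    ∑' q : Sites₀ t A, (if ∃ z ∈ Λ₀, (q : EuclideanSpace ℝ (Fin 3)) = t 1 + A z then
        ⟪forceConst (t 0 + A zp - q) ξ, ξ⟫ else 0) =
      ∑' z : Λ₀, ⟪forceConst (t 0 - (t 1 + A z)) ξ, ξ⟫ := by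
  let g : Λ₀ → Sites₀ t A := fun z => ⟨t 1 + A (zp + z), 1, zp + z, add_mem_Λ₀' hzp z.2, rfl⟩
  have hinj : Function.Injective g := by
    intro z z' h
    have h' : t 1 + A (zp + z) = t 1 + A (zp + z') := congrArg (fun q : Sites₀ t A => (q : EuclideanSpace ℝ (Fin 3))) h
    have := injective_of_adm₀ hA (add_left_cancel h')
    exact Subtype.ext (add_left_cancel this)
  have hsupp : Function.support (fun q : Sites₀ t A => (if ∃ z ∈ Λ₀, (q : EuclideanSpace ℝ (Fin 3)) = t 1 + A z then
      ⟪forceConst (t 0 + A zp - q) ξ, ξ⟫ else 0)) ⊆ Set.range g := by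
    intro q hq
    rw [Function.mem_support] at hq
    by_cases h : ∃ z ∈ Λ₀, (q : EuclideanSpace ℝ (Fin 3)) = t 1 + A z
    · obtain ⟨z, hz, hzq⟩ := h
      refine ⟨⟨z - zp, sub_mem_Λ₀' hz hzp⟩, Subtype.ext ?_⟩
      show t 1 + A (zp + (z - zp)) = q
      rw [hzq]; congr 1; congr 1; abel
    · exact absurd (if_neg h) hq
  rw [← hinj.tsum_eq hsupp]
  refine tsum_congr fun z => ?_
  have hex : ∃ z' ∈ Λ₀, ((g z : Sites₀ t A) : EuclideanSpace ℝ (Fin 3)) = t 1 + A z' := ⟨zp + z, add_mem_Λ₀' hzp z.2, rfl⟩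
  rw [if_pos hex]
  show ⟪forceConst (t 0 + A zp - (t 1 + A (zp + z))) ξ, ξ⟫ = _
  rw [map_add]
  congr 2
  abel

/-! ## The optical test field `u = ξ · 𝟙_F` -/

/-- The test field is finitely supported, with support in `F`. [folklore] -/
theorem support_indicatorField (F : Finset (EuclideanSpace ℝ (Fin 3))) (ξ : EuclideanSpace ℝ (Fin 3)) :
    Function.support (fun x : EuclideanSpace ℝ (Fin 3) => if x ∈ F then ξ else 0) ⊆ F := by
  intro x hx
  rw [Function.mem_support] at hx
  by_contra h
  exact hx (if_neg h)

/-- **Lower bound of the strain form**: every site `p ∈ F ⊆ S₀` has the cross neighbour `p + (t 1 − t 0) ∈ S₁`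
(outside `F`) within `11/10`, so `nnForm u ≥ #F · ‖ξ‖²`. [folklore] -/
theorem card_mul_le_nnForm (hA : Adm₀ A) (hI : Inner₀ t A) (F : Finset (EuclideanSpace ℝ (Fin 3)))
    (hF : ∀ x ∈ F, ∃ z ∈ Λ₀, x = t 0 + A z) (ξ : EuclideanSpace ℝ (Fin 3)) :
    (F.card : ℝ) * ‖ξ‖ ^ 2 ≤ nnForm t A (fun x => if x ∈ F then ξ else 0) := by
  classical
  set u : EuclideanSpace ℝ (Fin 3) → EuclideanSpace ℝ (Fin 3) := fun x => if x ∈ F then ξ else 0 with hu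
  have hfin : (Function.support u).Finite := F.finite_toSet.subset (support_indicatorField F ξ)
  have hFS : ∀ x ∈ F, x ∈ Sites₀ t A := fun x hx => by
    obtain ⟨z, hz, rfl⟩ := hF x hx; exact ⟨0, z, hz, rfl⟩
  -- the outer family and its restriction to `F`
  have hrows := summable_nnRows hA hI (u := u) hfin
  set FS : Finset (Sites₀ t A) := F.preimage Subtype.val Subtype.val_injective.injOn with hFSdef
  have h1 : ∑ p ∈ FS, (∑' q : Sites₀ t A, if dist (p : EuclideanSpace ℝ (Fin 3)) q ≤ 11 / 10 then ‖u p - u q‖ ^ 2 else 0) ≤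
      nnForm t A u :=
    hrows.sum_le_tsum FS fun p _ => tsum_nonneg fun q => by split_ifs <;> positivity
  -- each row from `p ∈ F` contains the cross term `‖ξ‖²`
  have h2 : ∀ p ∈ FS, ‖ξ‖ ^ 2 ≤ ∑' q : Sites₀ t A, if dist (p : EuclideanSpace ℝ (Fin 3)) q ≤ 11 / 10 then ‖u p - u q‖ ^ 2 else 0 := by
    intro p hp
    rw [hFSdef, Finset.mem_preimage] at hp
    obtain ⟨z, hz, hpz⟩ := hF _ hp
    let q₀ : Sites₀ t A := ⟨t 1 + A z, 1, z, hz, rfl⟩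
    have hq₀F : (q₀ : EuclideanSpace ℝ (Fin 3)) ∉ F := by
      intro h
      obtain ⟨z', hz', h'⟩ := hF _ h
      exact sublattice_ne hA hI hz' hz (h'.symm)
    have hdist : dist (p : EuclideanSpace ℝ (Fin 3)) q₀ ≤ 11 / 10 := by
      show dist (p : EuclideanSpace ℝ (Fin 3)) (t 1 + A z) ≤ 11 / 10
      rw [hpz, dist_eq_norm, show t 0 + A z - (t 1 + A z) = -(t 1 - t 0) by abel, norm_neg]
      exact norm_t_sub_t_le hA hI
    have hterm : (if dist (p : EuclideanSpace ℝ (Fin 3)) q₀ ≤ 11 / 10 then ‖u p - u q₀‖ ^ 2 else 0) = ‖ξ‖ ^ 2 := by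
      rw [if_pos hdist]
      simp only [hu, if_pos hp, if_neg hq₀F, sub_zero]
    rw [← hterm]
    exact (summable_nnRow hA hI u p).le_tsum q₀ fun q _ => by split_ifs <;> positivity
  have h3 : (F.card : ℝ) * ‖ξ‖ ^ 2 = ∑ p ∈ FS, ‖ξ‖ ^ 2 := by
    rw [Finset.sum_const, nsmul_eq_mul]
    congr 2
    rw [hFSdef, Finset.card_preimage]
    exact congrArg Finset.card (Finset.filter_true_of_mem fun x hx =>
      show x ∈ Set.range (Subtype.val : Sites₀ t A → EuclideanSpace ℝ (Fin 3)) from ⟨⟨x, hFS x hx⟩, rfl⟩).symm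
  rw [h3]
  exact (Finset.sum_le_sum h2).trans h1


/-! ## The operator pairing of the optical test field -/

/-- The pair family `G(p,q) = [p≠q] ⟪K(p−q)(u p − u q), u p⟫` of the optical test field: off `F` it vanishes, on
`p ∈ F` it is `[q ∉ F] ⟪K(p−q) ξ, ξ⟫`. [folklore] -/
theorem pairFamily_indicator (F : Finset (EuclideanSpace ℝ (Fin 3))) (ξ : EuclideanSpace ℝ (Fin 3)) (p q : Sites₀ t A) :
    (if (p : (EuclideanSpace ℝ (Fin 3))) ≠ q then ⟪((-((‖(p : (EuclideanSpace ℝ (Fin 3))) - q‖ ^ 2)⁻¹) ^ 7 + ((‖(p : (EuclideanSpace ℝ (Fin 3))) - q‖ ^ 2)⁻¹) ^ 4) • ((fun x : EuclideanSpace ℝ (Fin 3) => if x ∈ F then ξ else 0) p - (fun x : EuclideanSpace ℝ (Fin 3) => if x ∈ F then ξ else 0) q) + (2 * ⟪(p : (EuclideanSpace ℝ (Fin 3))) - q, (fun x : EuclideanSpace ℝ (Fin 3) => if x ∈ F then ξ else 0) p - (fun x : EuclideanSpace ℝ (Fin 3) => if x ∈ F then ξ else 0) q⟫ * (7 * ((‖(p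 : (EuclideanSpace ℝ (Fin 3))) - q‖ ^ 2)⁻¹) ^ 8 - 4 * ((‖(p : (EuclideanSpace ℝ (Fin 3))) - q‖ ^ 2)⁻¹) ^ 5)) • ((p : (EuclideanSpace ℝ (Fin 3))) - q)), (fun x : EuclideanSpace ℝ (Fin 3) => if x ∈ F then ξ else 0) p⟫ else 0) =
      (if (p : EuclideanSpace ℝ (Fin 3)) ∈ F then
        (if (q : EuclideanSpace ℝ (Fin 3)) ∉ F then ⟪forceConst ((p : EuclideanSpace ℝ (Fin 3)) - q) ξ, ξ⟫ else 0) else 0) := by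
  by_cases hp : (p : EuclideanSpace ℝ (Fin 3)) ∈ F
  · rw [if_pos hp]
    by_cases hq : (q : EuclideanSpace ℝ (Fin 3)) ∈ F
    · rw [if_neg (not_not.2 hq)]
      by_cases hpq : (p : EuclideanSpace ℝ (Fin 3)) = q
      · rw [if_neg (not_not.2 hpq)]
      · rw [if_pos hpq]
        simp [hp, hq]
    · have hpq : (p : EuclideanSpace ℝ (Fin 3)) ≠ q := fun h => hq (h ▸ hp)
      rw [if_pos hpq, if_pos hq]
      simp only [if_pos hp, if_neg hq, sub_zero, forceConst_apply]
  · rw [if_neg hp]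
    simp [hp]

/-- **Row estimate**: for `p ∈ F`, `Σ'_q [q ∉ F] ⟪K(p−q) ξ, ξ⟫ ≤ Q(ξ) + 38 ‖ξ‖² · Σ'_{q ∈ S₀ ∖ F} dist(p,q)⁻⁸` — the sublattice-`1`
part is exactly the optical row, the rest of sublattice `0` is boundary. [folklore] -/
theorem optical_row_le (hA : Adm₀ A) (hI : Inner₀ t A) (F : Finset (EuclideanSpace ℝ (Fin 3)))
    (hF : ∀ x ∈ F, ∃ z ∈ Λ₀, x = t 0 + A z) (ξ : EuclideanSpace ℝ (Fin 3)) (p : Sites₀ t A) (hp : (p : EuclideanSpace ℝ (Fin 3)) ∈ F) :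
    ∑' q : Sites₀ t A, (if (q : EuclideanSpace ℝ (Fin 3)) ∉ F then ⟪forceConst ((p : EuclideanSpace ℝ (Fin 3)) - q) ξ, ξ⟫ else 0) ≤
      (∑' z : Λ₀, ⟪forceConst (t 0 - (t 1 + A z)) ξ, ξ⟫) + 38 * ‖ξ‖ ^ 2 * (∑' q : Sites₀ t A, (if (∃ z ∈ Λ₀, (q : EuclideanSpace ℝ (Fin 3)) = t 0 + A z) ∧ (q : EuclideanSpace ℝ (Fin 3)) ∉ F then (dist (p : EuclideanSpace ℝ (Fin 3)) q)⁻¹ ^ 8 else 0)) := by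
  classical
  obtain ⟨zp, hzp, hpz⟩ := hF _ hp
  -- membership bookkeeping: every site is on exactly one sublattice
  have hS0 : ∀ q : Sites₀ t A, (∃ z ∈ Λ₀, (q : EuclideanSpace ℝ (Fin 3)) = t 0 + A z) ∨ (∃ z ∈ Λ₀, (q : EuclideanSpace ℝ (Fin 3)) = t 1 + A z) := by
    intro q
    obtain ⟨m, z, hz, hq⟩ := q.2
    fin_cases m
    · exact Or.inl ⟨z, hz, hq⟩
    · exact Or.inr ⟨z, hz, hq⟩
  have hS01 : ∀ q : Sites₀ t A, (∃ z ∈ Λ₀, (q : EuclideanSpace ℝ (Fin 3)) = t 0 + A z) → ¬ (∃ z ∈ Λ₀, (q : EuclideanSpace ℝ (Fin 3)) = t 1 + A z) := by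
    rintro q ⟨z, hz, hq⟩ ⟨z', hz', hq'⟩
    exact sublattice_ne hA hI hz hz' (hq.symm.trans hq')
  have hF0 : ∀ q : Sites₀ t A, (q : EuclideanSpace ℝ (Fin 3)) ∈ F → ∃ z ∈ Λ₀, (q : EuclideanSpace ℝ (Fin 3)) = t 0 + A z :=
    fun q hq => hF _ hq
  -- the two sub-families
  set a : Sites₀ t A → ℝ := fun q => if ∃ z ∈ Λ₀, (q : EuclideanSpace ℝ (Fin 3)) = t 1 + A z then
      ⟪forceConst (t 0 + A zp - q) ξ, ξ⟫ else 0 with ha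
  set b : Sites₀ t A → ℝ := fun q => if (∃ z ∈ Λ₀, (q : EuclideanSpace ℝ (Fin 3)) = t 0 + A z) ∧ (q : EuclideanSpace ℝ (Fin 3)) ∉ F then
      ⟪forceConst ((p : EuclideanSpace ℝ (Fin 3)) - q) ξ, ξ⟫ else 0 with hb
  have hsplit : ∀ q : Sites₀ t A, (if (q : EuclideanSpace ℝ (Fin 3)) ∉ F then ⟪forceConst ((p : EuclideanSpace ℝ (Fin 3)) - q) ξ, ξ⟫ else 0) =
      a q + b q := by
    intro q
    simp only [ha, hb]
    by_cases hq : (q : EuclideanSpace ℝ (Fin 3)) ∈ F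
    · rw [if_neg (not_not.2 hq), if_neg (hS01 q (hF0 q hq)), if_neg (fun h => h.2 hq), add_zero]
    · rw [if_pos hq]
      rcases hS0 q with h0 | h1
      · rw [if_neg (hS01 q h0), if_pos ⟨h0, hq⟩, zero_add]
      · have : ¬ ((∃ z ∈ Λ₀, (q : EuclideanSpace ℝ (Fin 3)) = t 0 + A z) ∧ (q : EuclideanSpace ℝ (Fin 3)) ∉ F) :=
          fun h => hS01 q h.1 h1
        rw [if_pos h1, if_neg this, add_zero, hpz]
  -- pointwise bounds by the summable kernel `38 ‖ξ‖² d⁻⁸`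
  have hker := (summable_inv_pow_eight_sites hA hI p.2).mul_left (38 * ‖ξ‖ ^ 2)
  have hbd : ∀ q : Sites₀ t A, (q : EuclideanSpace ℝ (Fin 3)) ≠ p →
      |⟪forceConst ((p : EuclideanSpace ℝ (Fin 3)) - q) ξ, ξ⟫| ≤ 38 * ‖ξ‖ ^ 2 * (dist (q : EuclideanSpace ℝ (Fin 3)) p)⁻¹ ^ 8 := by
    intro q hq
    have he := norm_sub_ge_of_sites hA hI p.2 q.2 (Ne.symm hq)
    refine (abs_inner_forceConst_le he ξ).trans (le_of_eq ?_)
    rw [dist_comm, dist_eq_norm]; ring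
  have hbd' : ∀ q : Sites₀ t A, (q : EuclideanSpace ℝ (Fin 3)) ≠ p →
      |⟪forceConst (t 0 + A zp - q) ξ, ξ⟫| ≤ 38 * ‖ξ‖ ^ 2 * (dist (q : EuclideanSpace ℝ (Fin 3)) p)⁻¹ ^ 8 := by
    intro q hq; rw [← hpz]; exact hbd q hq
  have hrhs0 : ∀ q : Sites₀ t A, 0 ≤ 38 * ‖ξ‖ ^ 2 *
      (if (q : EuclideanSpace ℝ (Fin 3)) ≠ p then (dist (q : EuclideanSpace ℝ (Fin 3)) p)⁻¹ ^ 8 else 0) :=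
    fun q => mul_nonneg (by positivity) (by split_ifs <;> positivity)
  have ha_s : Summable a := by
    refine Summable.of_norm_bounded hker fun q => ?_
    by_cases h1 : ∃ z ∈ Λ₀, (q : EuclideanSpace ℝ (Fin 3)) = t 1 + A z
    · have hq : (q : EuclideanSpace ℝ (Fin 3)) ≠ p := by
        rintro hqp
        obtain ⟨z', hz', hq'⟩ := h1
        exact sublattice_ne hA hI hzp hz' (hpz.symm.trans (hqp.symm.trans hq'))
      have hav : a q = ⟪forceConst (t 0 + A zp - q) ξ, ξ⟫ := by simp only [ha, if_pos h1]
      rw [hav, Real.norm_eq_abs, if_pos hq]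
      exact hbd' q hq
    · have hav : a q = 0 := by simp only [ha, if_neg h1]
      rw [hav, norm_zero]
      exact hrhs0 q
  have hb_s : Summable b := by
    refine Summable.of_norm_bounded hker fun q => ?_
    by_cases h1 : (∃ z ∈ Λ₀, (q : EuclideanSpace ℝ (Fin 3)) = t 0 + A z) ∧ (q : EuclideanSpace ℝ (Fin 3)) ∉ F
    · have hq : (q : EuclideanSpace ℝ (Fin 3)) ≠ p := fun hqp => h1.2 (hqp ▸ hp)
      have hbv : b q = ⟪forceConst ((p : EuclideanSpace ℝ (Fin 3)) - q) ξ, ξ⟫ := by simp only [hb, if_pos h1]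
      rw [hbv, Real.norm_eq_abs, if_pos hq]
      exact hbd q hq
    · have hbv : b q = 0 := by simp only [hb, if_neg h1]
      rw [hbv, norm_zero]
      exact hrhs0 q
  have hT_s : Summable (fun q : Sites₀ t A => (if (∃ z ∈ Λ₀, (q : EuclideanSpace ℝ (Fin 3)) = t 0 + A z) ∧
      (q : EuclideanSpace ℝ (Fin 3)) ∉ F then (dist (p : EuclideanSpace ℝ (Fin 3)) q)⁻¹ ^ 8 else 0)) := by
    refine Summable.of_nonneg_of_le (fun q => by split_ifs <;> positivity) (fun q => ?_)
      (summable_inv_pow_eight_sites hA hI p.2)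
    by_cases h1 : (∃ z ∈ Λ₀, (q : EuclideanSpace ℝ (Fin 3)) = t 0 + A z) ∧ (q : EuclideanSpace ℝ (Fin 3)) ∉ F
    · have hq : (q : EuclideanSpace ℝ (Fin 3)) ≠ p := fun hqp => h1.2 (hqp ▸ hp)
      rw [if_pos h1, if_pos hq, dist_comm]
    · rw [if_neg h1]
      split_ifs <;> positivity
  -- assemble
  rw [tsum_congr hsplit, ha_s.tsum_add hb_s, tsum_cross_eq_optRow hA ξ hzp]
  refine add_le_add le_rfl ?_
  rw [← tsum_mul_left]
  refine hb_s.tsum_le_tsum (fun q => ?_) (hT_s.mul_left _)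
  by_cases h1 : (∃ z ∈ Λ₀, (q : EuclideanSpace ℝ (Fin 3)) = t 0 + A z) ∧ (q : EuclideanSpace ℝ (Fin 3)) ∉ F
  · have hq : (q : EuclideanSpace ℝ (Fin 3)) ≠ p := fun hqp => h1.2 (hqp ▸ hp)
    have hbv : b q = ⟪forceConst ((p : EuclideanSpace ℝ (Fin 3)) - q) ξ, ξ⟫ := by simp only [hb, if_pos h1]
    rw [hbv, if_pos h1, dist_comm]
    exact (le_abs_self _).trans (hbd q hq)
  · have hbv : b q = 0 := by simp only [hb, if_neg h1]
    rw [hbv, if_neg h1, mul_zero]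

/-- **The finite-volume optical inequality** (see the module docstring). [folklore] -/
theorem optical_finite_volume {κ : ℝ} (hκ : 0 < κ) (hA : Adm₀ A) (hI : Inner₀ t A) (hPS : PSIneq κ t A)
    (F : Finset (EuclideanSpace ℝ (Fin 3))) (hF : ∀ x ∈ F, ∃ z ∈ Λ₀, x = t 0 + A z) (ξ : EuclideanSpace ℝ (Fin 3)) :
    κ * F.card * ‖ξ‖ ^ 2 ≤ F.card * (∑' z : Λ₀, ⟪forceConst (t 0 - (t 1 + A z)) ξ, ξ⟫) + 38 * ‖ξ‖ ^ 2 * ∑ x ∈ F, (∑' q : Sites₀ t A, (if (∃ z ∈ Λ₀, (q : EuclideanSpace ℝ (Fin 3)) = t 0 + A z) ∧ (q : EuclideanSpace ℝ (Fin 3)) ∉ F then (dist x (q : EuclideanSpace ℝ (Fin 3)))⁻¹ ^ 8 else 0)) := by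
  classical
  set U : EuclideanSpace ℝ (Fin 3) → EuclideanSpace ℝ (Fin 3) := fun x => if x ∈ F then ξ else 0 with hU
  have hfin : (Function.support U).Finite := F.finite_toSet.subset (support_indicatorField F ξ)
  have hFS : ∀ x ∈ F, x ∈ Sites₀ t A := fun x hx => by
    obtain ⟨z, hz, rfl⟩ := hF x hx; exact ⟨0, z, hz, rfl⟩
  have hsuppS : Function.support U ⊆ Sites₀ t A := fun x hx => hFS x (support_indicatorField F ξ hx)
  -- stability in operator form
  have h1 : κ * nnForm t A U ≤ ∑' p : Sites₀ t A, ∑' q : Sites₀ t A, (if (p : (EuclideanSpace ℝ (Fin 3))) ≠ q then ⟪((-((‖(p : (EuclideanSpace ℝ (Fin 3))) - q‖ ^ 2)⁻¹) ^ 7 + ((‖(p : (EuclideanSpace ℝ (Fin 3))) - q‖ ^ 2)⁻¹) ^ 4) • (U p - U q) + (2 * ⟪(p : (EuclideanSpace ℝ (Fin 3))) - q, U p - U q⟫ * (7 * ((‖(p : (EuclideanSpace ℝ (Fin 3))) - q‖ ^ 2)⁻¹) ^ 8 - 4 * ((‖(p : (EuclideanSpace ℝ (Fin 3))) - q‖ ^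 2)⁻¹) ^ 5)) • ((p : (EuclideanSpace ℝ (Fin 3))) - q)), U p⟫ else 0) := by
    have hE := energy_identity hA hI hfin (v := U)
    have hPSu := hPS U hfin hsuppS
    rw [tsum_congr fun p => (tsum_pairRow_eq_inner hA hI hfin p), hE]
    unfold hessForm at hPSu
    linarith
  -- the outer sum is a finite sum over `F`
  set FS : Finset (Sites₀ t A) := F.preimage Subtype.val Subtype.val_injective.injOn with hFSdef
  have hmemFS : ∀ p : Sites₀ t A, p ∈ FS ↔ (p : EuclideanSpace ℝ (Fin 3)) ∈ F := fun p => by rw [hFSdef, Finset.mem_preimage]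
  have h2 : ∑' p : Sites₀ t A, ∑' q : Sites₀ t A, (if (p : (EuclideanSpace ℝ (Fin 3))) ≠ q then ⟪((-((‖(p : (EuclideanSpace ℝ (Fin 3))) - q‖ ^ 2)⁻¹) ^ 7 + ((‖(p : (EuclideanSpace ℝ (Fin 3))) - q‖ ^ 2)⁻¹) ^ 4) • (U p - U q) + (2 * ⟪(p : (EuclideanSpace ℝ (Fin 3))) - q, U p - U q⟫ * (7 * ((‖(p : (EuclideanSpace ℝ (Fin 3))) - q‖ ^ 2)⁻¹) ^ 8 - 4 * ((‖(p : (EuclideanSpace ℝ (Fin 3))) - q‖ ^ 2)⁻¹) ^ 5)) • ((p : (EuclideanSpace ℝ (Fin 3))) - q)), U p⟫ else 0) =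
      ∑ p ∈ FS, ∑' q : Sites₀ t A,
        (if (q : EuclideanSpace ℝ (Fin 3)) ∉ F then ⟪forceConst ((p : EuclideanSpace ℝ (Fin 3)) - q) ξ, ξ⟫ else 0) := by
    rw [tsum_eq_sum (s := FS)]
    · refine Finset.sum_congr rfl fun p hp => tsum_congr fun q => ?_
      rw [hU, pairFamily_indicator F ξ p q, if_pos ((hmemFS p).1 hp)]
    · intro p hp
      refine (tsum_congr fun q => ?_).trans tsum_zero
      rw [hU, pairFamily_indicator F ξ p q, if_neg (fun h => hp ((hmemFS p).2 h))]
  have h3 : ∑ p ∈ FS, ∑' q : Sites₀ t A,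
        (if (q : EuclideanSpace ℝ (Fin 3)) ∉ F then ⟪forceConst ((p : EuclideanSpace ℝ (Fin 3)) - q) ξ, ξ⟫ else 0) ≤
      ∑ p ∈ FS, ((∑' z : Λ₀, ⟪forceConst (t 0 - (t 1 + A z)) ξ, ξ⟫) + 38 * ‖ξ‖ ^ 2 * (∑' q : Sites₀ t A, (if (∃ z ∈ Λ₀, (q : EuclideanSpace ℝ (Fin 3)) = t 0 + A z) ∧ (q : EuclideanSpace ℝ (Fin 3)) ∉ F then (dist (p : EuclideanSpace ℝ (Fin 3)) q)⁻¹ ^ 8 else 0))) :=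
    Finset.sum_le_sum fun p hp => optical_row_le hA hI F hF ξ p ((hmemFS p).1 hp)
  have hcard : (FS.card : ℝ) = F.card := by
    rw [hFSdef, Finset.card_preimage]
    exact congrArg (fun s : Finset (EuclideanSpace ℝ (Fin 3)) => (s.card : ℝ)) (Finset.filter_true_of_mem fun x hx =>
      show x ∈ Set.range (Subtype.val : Sites₀ t A → EuclideanSpace ℝ (Fin 3)) from ⟨⟨x, hFS x hx⟩, rfl⟩)
  have h4 : ∑ p ∈ FS, ((∑' z : Λ₀, ⟪forceConst (t 0 - (t 1 + A z)) ξ, ξ⟫) + 38 * ‖ξ‖ ^ 2 * (∑' q : Sites₀ t A, (if (∃ z ∈ Λ₀, (q : EuclideanSpace ℝ (Fin 3)) = t 0 + A z) ∧ (q : EuclideanSpace ℝ (Fin 3)) ∉ F then (dist (p : EuclideanSpace ℝ (Fin 3)) q)⁻¹ ^ 8 else 0))) = F.card * (∑' z : Λ₀, ⟪forceConst (t 0 - (t 1 + A z)) ξ, ξ⟫) + 38 * ‖ξ‖ ^ 2 * ∑ x ∈ F, (∑' q : Sites₀ t A, (if (∃ z ∈ Λ₀, (q : EuclideanSpace ℝ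 (Fin 3)) = t 0 + A z) ∧ (q : EuclideanSpace ℝ (Fin 3)) ∉ F then (dist x (q : EuclideanSpace ℝ (Fin 3)))⁻¹ ^ 8 else 0)) := by
    rw [Finset.sum_add_distrib, Finset.sum_const, nsmul_eq_mul, hcard, ← Finset.mul_sum]
    congr 1
    congr 1
    rw [hFSdef]
    exact Finset.sum_preimage Subtype.val F Subtype.val_injective.injOn (fun x => (∑' q : Sites₀ t A, (if (∃ z ∈ Λ₀, (q : EuclideanSpace ℝ (Fin 3)) = t 0 + A z) ∧ (q : EuclideanSpace ℝ (Fin 3)) ∉ F then (dist x (q : EuclideanSpace ℝ (Fin 3)))⁻¹ ^ 8 else 0)))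
      (fun x hx hx' => absurd ⟨⟨x, hFS x hx⟩, rfl⟩ hx')
  have h5 := card_mul_le_nnForm hA hI F hF ξ
  calc κ * F.card * ‖ξ‖ ^ 2 = κ * (F.card * ‖ξ‖ ^ 2) := by ring
    _ ≤ κ * nnForm t A U := mul_le_mul_of_nonneg_left h5 hκ.le
    _ ≤ _ := h1
    _ = _ := h2
    _ ≤ _ := h3
    _ = _ := h4


/-- Registered sub-goal carrying this file (crux stmt-AtomisticToContinuum-9332, line `Sketch` v4, part H3c of
`stub_green`): the finite-volume optical inequality. [folklore] -/
theorem _root_.Summit.AtomisticToContinuum.Crystallization.Theorems.ExcessDecayLiouville.blowdown_opticalFinite :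
    ∀ (κ : ℝ) (t : Fin 2 → EuclideanSpace ℝ (Fin 3)) (A : EuclideanSpace ℝ (Fin 3) →L[ℝ] EuclideanSpace ℝ (Fin 3)), 0 < κ → Adm₀ A → Inner₀ t A → Blowdown.PSIneq κ t A → ∀ (F : Finset (EuclideanSpace ℝ (Fin 3))), (∀ x ∈ F, ∃ z ∈ Λ₀, x = t 0 + A z) → ∀ ξ : EuclideanSpace ℝ (Fin 3), κ * F.card * ‖ξ‖ ^ 2 ≤ F.card * (∑' z : Λ₀, ⟪forceConst (t 0 - (t 1 + A z)) ξ, ξ⟫) + 38 * ‖ξ‖ ^ 2 * ∑ x ∈ F, (∑' q : Sites₀ t A, (if (∃ z ∈ Λ₀, (q : EuclideanSpace ℝ (Fin 3)) = t 0 + A z) ∧ (q : EuclideanSpace ℝ (Fin 3)) ∉ F then (dist x (q : EuclideanSpace ℝ (Fin 3)))⁻¹ ^ 8 else 0)) :=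
  fun _ _ _ hκ hA hI hPS F hF ξ => optical_finite_volume hκ hA hI hPS F hF ξ

end

end Blowdown

end Summit.AtomisticToContinuum.Crystallization.Theorems.ExcessDecayLiouville

end
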